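import Literature.MathematicalPhysics.QuantumLattice.InfVolFermionStateHubbardMeanEnergyBox
import Literature.MathematicalPhysics.QuantumLattice.HubbardNNNHoppingLocalHamiltonian
import Literature.MathematicalPhysics.QuantumLattice.HubbardOpenBoxVersusTorus
import HarnessLib

/-!
# The `t–t'` mean energy of a translation-invariant state versus its box Hamiltonians

Topic `Literature/MathematicalPhysics/QuantumLattice`; namespace
`Literature.MathematicalPhysics.QuantumLattice` (the file path). The `t–t'` twin of
`InfVolFermionStateHubbardMeanEnergyBox.lean`: for a TRANSLATION-INVARIANT infinite-volume state `ω`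
of the lattice fermion system on `ℤ²`, the expectations of the diagonal bond terms
`Φ^{t'}{x, x + j_s}` (`j_s = e₁ ± e₂`) of the `t–t'` Hubbard interaction
(`HubbardNNNHoppingInteraction.lean`) do not depend on `x`; the diagonal part of the mean energy is
`Σ_s h'_s`, `h'_s = ω(Φ^{t'}{0, j_s})`, the diagonal part of the free-boundary box Hamiltonian of a
finite `Λ` has expectation `Σ_s #{x ∈ Λ : x + j_s ∈ Λ} h'_s`, `|Re h'_s| ≤ 4|t'|`, and in the box
`[0,ℓ)²` at most `2ℓ` sites lose their `j_s`-neighbour; hence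
`|ℓ² e^{tt'}(ω) - Re ω(H^{tt'}_{[0,ℓ)²})| ≤ (8|t| + 16|t'|) ℓ` — the first step of the variational
principle for the `t–t'` energy density (Bratteli–Robinson II §6.2.4, Prop. 6.2.38 ff.: the mean
energy of a periodic state is `lim ω(H_Λ)/|Λ|`). Everything is PROVED; no definition, no named fact.

## Results

* `IsTranslationInvariant.expect_diagHopping_pair`: `ω(Φ^{t'}{x, x + j_s}) = ω(Φ^{t'}{0, j_s})`.
* `IsTranslationInvariant.expect_diagHopping_meanEnergyObs`: `ω(E^{t'}) = Σ_s h'_s`.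
* `IsTranslationInvariant.expect_diagHopping_localHamiltonian`:
  `ω(H^{t'}_Λ) = Σ_s #{x ∈ Λ : x + j_s ∈ Λ} h'_s`.
* `abs_re_expect_diagHopping_pair_le`: `|Re h'_s| ≤ 4|t'|`.
* `card_filter_add_diagVec_not_mem_halfOpenBox_le`: `#{x ∈ [0,ℓ)² : x + j_s ∉ [0,ℓ)²} ≤ 2ℓ`.
* `IsTranslationInvariant.meanEnergy_hubbardTTPrime_eq`: `e^{tt'}(ω) = e^{t,U}(ω) + Σ_s Re h'_s`.
* `IsTranslationInvariant.abs_sq_mul_meanEnergyTTPrime_sub_re_expect_localHamiltonian_le`: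
  `|ℓ² e^{tt'}(ω) - Re ω(H^{tt'}_{[0,ℓ)²})| ≤ (8|t| + 16|t'|) ℓ`.
-/

noncomputable section

namespace Literature.MathematicalPhysics.QuantumLattice

open Matrix Finset HubbardWave0 Literature.Probability.LatticeModels ThermodynamicLimit
open scoped ComplexOrder

variable (t' : ℝ)

namespace InfVolFermionState

/-! ### Translation invariance of the diagonal bond expectations -/

/-- `shiftSet x {0, 0 + v} ⊆ {x, x + v}`. [folklore] -/
private theorem shiftSet_pair_zero_subset' {d : ℕ} (x v : Site d) :
    shiftSet x ({0, 0 + v} : Finset (Site d)) ⊆ {x, x + v} := by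
  intro y hy
  rw [mem_shiftSet, mem_insert, mem_singleton] at hy
  rw [mem_insert, mem_singleton]
  rcases hy with h | h
  · exact Or.inl (sub_eq_zero.1 h)
  · right; rw [zero_add] at h; rw [← sub_add_cancel y x, h, add_comm]

variable {ω : InfVolFermionState 2}

/-- **The diagonal bond energy does not depend on the bond**: for translation-invariant `ω`,
`ω(Φ^{t'}{x, x + j_s}) = ω(Φ^{t'}{0, j_s})`. [cite: BratteliRobinsonI1987, §4.3.1] -/
theorem IsTranslationInvariant.expect_diagHopping_pair (hω : ω.IsTranslationInvariant) (x : Site 2) (s : Fin 2) :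
    ω.expect {x, x + diagVec s} ((diagHoppingFermionInteraction t').Φ {x, x + diagVec s}) =
      ω.expect {0, 0 + diagVec s} ((diagHoppingFermionInteraction t').Φ {0, 0 + diagVec s}) := by
  conv_rhs => rw [← hω x, shift_expect]
  refine ω.expect_fermionEmbed_incl_eq (subset_refl _) (shiftSet_pair_zero_subset' x (diagVec s)) _ _ ?_
  have hc : ∀ (y : Site 2) (hy : y ∈ ({0, 0 + diagVec s} : Finset (Site 2))) (σ : Fin 2),
      fermionEmbed ((PolySite.shiftEmb x {0, 0 + diagVec s}).trans
        (PolySite.incl (shiftSet_pair_zero_subset' x (diagVec s))))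
        (cAt y hy σ) = cAt (y + x) (shiftSet_pair_zero_subset' x (diagVec s) (PolySite.add_mem_shiftSet x hy)) σ := by
    intro y hy σ
    rw [cAt, fermionEmbed_annihilation]
    rfl
  have h0 : ∀ (h : 0 + x ∈ ({x, x + diagVec s} : Finset (Site 2))) (h' : x ∈ ({x, x + diagVec s} : Finset (Site 2)))
      (σ : Fin 2), cAt (0 + x) h σ = cAt x h' σ := fun h h' σ => cAt_congr h h' (zero_add x) σ
  have h1 : ∀ (h : 0 + diagVec s + x ∈ ({x, x + diagVec s} : Finset (Site 2)))
      (h' : x + diagVec s ∈ ({x, x + diagVec s} : Finset (Site 2))) (σ : Fin 2),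
      cAt (0 + diagVec s + x) h σ = cAt (x + diagVec s) h' σ := fun h h' σ =>
    cAt_congr h h' (by rw [zero_add, add_comm]) σ
  simp only [diagHoppingFermionInteraction_apply_pair, fermionEmbed_smul, fermionEmbed_sum, fermionEmbed_add,
    fermionEmbed_mul, fermionEmbed_conjTranspose, fermionEmbed_fermionEmbed, fermionEmbed_incl_cAt, hc,
    h0 _ (mem_insert_self _ _), h1 _ (mem_insert_of_mem (mem_singleton_self _))]

/-! ### The diagonal mean energy and box Hamiltonians through `h'_s` -/

/-- **The diagonal part of the energy density through the bond expectations**: for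
translation-invariant `ω`, `ω(E^{t'}) = Σ_s ω(Φ^{t'}{0, j_s})` (the two half bonds through the origin
in the diagonal direction `s` have the same expectation).
[cite: BratteliKishimotoRobinson1978, §3 (mean energy functional)] -/
theorem IsTranslationInvariant.expect_diagHopping_meanEnergyObs (hω : ω.IsTranslationInvariant) :
    ω.expect (thicken ({0} : Finset (Site 2)) 1) ((diagHoppingFermionInteraction t').meanEnergyObs 1) =
      ∑ s : Fin 2, ω.expect {0, 0 + diagVec s} ((diagHoppingFermionInteraction t').Φ {0, 0 + diagVec s}) := by
  rw [diagHoppingFermionInteraction_meanEnergyObs, map_sum]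
  refine Finset.sum_congr rfl fun s _ => ?_
  rw [map_add, map_smul, map_smul, ω.compatible, ω.compatible]
  have h := hω.expect_diagHopping_pair t' (-diagVec s) s
  rw [h, ← add_smul]
  norm_num

/-- **The diagonal box Hamiltonians through the bond expectations**: for translation-invariant `ω`
and every finite region `Λ ⊆ ℤ²`, `ω(H^{t'}_Λ) = Σ_s #{x ∈ Λ : x + j_s ∈ Λ} ω(Φ^{t'}{0, j_s})`.
[cite: BratteliRobinsonII1997, §6.2.4 (Prop. 6.2.38 ff.)] -/
theorem IsTranslationInvariant.expect_diagHopping_localHamiltonian (hω : ω.IsTranslationInvariant)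
    (Λ : Finset (Site 2)) :
    ω.expect Λ ((diagHoppingFermionInteraction t').localHamiltonian Λ) =
      ∑ s : Fin 2, ((Λ.filter fun x => x + diagVec s ∈ Λ).card : ℂ) *
        ω.expect {0, 0 + diagVec s} ((diagHoppingFermionInteraction t').Φ {0, 0 + diagVec s}) := by
  classical
  rw [FermionInteraction.localHamiltonian_eq_sum, map_sum]
  have hterm : ∀ X : Finset (Site 2), ω.expect Λ (if h : X ⊆ Λ then
      fermionEmbed (PolySite.incl h) ((diagHoppingFermionInteraction t').Φ X) else 0) =
      if X ⊆ Λ then ω.expect X ((diagHoppingFermionInteraction t').Φ X) else 0 := by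
    intro X
    by_cases h : X ⊆ Λ
    · rw [dif_pos h, if_pos h, ω.compatible]
    · rw [dif_neg h, if_neg h, map_zero]
  simp_rw [hterm]
  rw [sum_powerset_eq_of_diag_support Λ _ (fun X hX => by
    rw [diagHoppingFermionInteraction_apply_eq_zero t' hX, map_zero, ite_self])]
  rw [Finset.sum_filter, Finset.sum_product, Finset.sum_comm]
  refine Finset.sum_congr rfl fun s _ => ?_
  rw [Finset.card_filter, Nat.cast_sum, Finset.sum_mul]
  refine Finset.sum_congr rfl fun x hx => ?_
  by_cases h : x + diagVec s ∈ Λ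
  · rw [if_pos h, if_pos (insert_subset hx (singleton_subset_iff.2 h)), hω.expect_diagHopping_pair t' x s, if_pos h,
      Nat.cast_one, one_mul]
  · rw [if_neg h, if_neg h, Nat.cast_zero, zero_mul]

/-! ### The diagonal bond energy is bounded -/

/-- **The diagonal bond energy is at most `4|t'|` in modulus**: `|Re ω(Φ^{t'}{0, j_s})| ≤ 4|t'|` for
every state (contractivity of states and `‖Φ^{t'}{0, j_s}‖ ≤ 4|t'|`). [cite: BratteliRobinsonI1987, Prop. 2.3.11] -/
theorem abs_re_expect_diagHopping_pair_le (ω : InfVolFermionState 2) (s : Fin 2) :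
    |(ω.expect {0, 0 + diagVec s} ((diagHoppingFermionInteraction t').Φ {0, 0 + diagVec s})).re| ≤ 4 * |t'| := by
  refine (ω.abs_re_expect_le _ _).trans ?_
  rw [diagHoppingFermionInteraction_apply_pair]
  exact norm_hoppingTerm_le t' (fun σ => orb (PolySite.pt 0 (mem_insert_self _ _)) σ)
    (fun σ => orb (PolySite.pt (0 + diagVec s) (mem_insert_of_mem (mem_singleton_self _))) σ)

/-! ### The boxes `[0,ℓ)²`: the diagonal boundary bonds -/

/-- A coordinate hyperplane meets the box `[0,ℓ)²` in at most `ℓ` sites. [folklore] -/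
private theorem card_filter_apply_eq_le (ℓ : ℕ) (i j : Fin 2) (hcover : ∀ k : Fin 2, k ≠ i → k = j) (c : ℤ) :
    ((halfOpenBox 2 ℓ).filter fun x => x i = c).card ≤ ℓ := by
  classical
  calc ((halfOpenBox 2 ℓ).filter fun x => x i = c).card
      ≤ (Finset.range ℓ).card := by
        refine Finset.card_le_card_of_injOn (fun x => (x j).toNat) ?_ ?_
        · intro x hx
          have hx' := (mem_filter.1 (mem_coe.1 hx)).1
          rw [mem_halfOpenBox] at hx'
          have := hx' j
          rw [mem_coe, mem_range]
          dsimp only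
          omega
        · intro x hx y hy hxy
          have hxm := (mem_filter.1 (mem_coe.1 hx))
          have hym := (mem_filter.1 (mem_coe.1 hy))
          rw [mem_halfOpenBox] at hxm hym
          have hxj := hxm.1 j; have hyj := hym.1 j
          have hj : x j = y j := by simp only at hxy; omega
          have hi : x i = y i := by rw [hxm.2, hym.2]
          funext k
          by_cases hk : k = i
          · rw [hk, hi]
          · rw [hcover k hk, hj]
    _ = ℓ := Finset.card_range ℓ

/-- A site of the box whose `j_s`-neighbour leaves the box lies on the last column or on the
extreme row in the direction of `j_s`. [folklore] -/
private theorem coord_eq_of_add_diagVec_not_mem {ℓ : ℕ} {s : Fin 2} {x : Site 2} (hx : x ∈ halfOpenBox 2 ℓ)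
    (hout : x + diagVec s ∉ halfOpenBox 2 ℓ) :
    x 0 = (ℓ : ℤ) - 1 ∨ x 1 = (if s = 0 then (ℓ : ℤ) - 1 else 0) := by
  rw [mem_halfOpenBox] at hx
  rw [mem_halfOpenBox, not_forall] at hout
  obtain ⟨k, hk⟩ := hout
  have hx0 := hx 0; have hx1 := hx 1
  rw [Pi.add_apply] at hk
  rcases fin_two_eq_zero_or_one k with rfl | rfl
  · rw [diagVec_apply_zero] at hk; left; omega
  · rw [diagVec_apply_one] at hk
    right
    by_cases hs : s = 0
    · rw [if_pos hs] at hk ⊢; omega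
    · rw [if_neg hs] at hk ⊢; omega

/-- **In the box `[0,ℓ)²`, the sites whose diagonal neighbour `x + j_s` leaves the box are at most
`2ℓ`** (the last column and one extreme row). [folklore] -/
private theorem card_filter_add_diagVec_not_mem_halfOpenBox_le (ℓ : ℕ) (s : Fin 2) :
    ((halfOpenBox 2 ℓ).filter fun x => x + diagVec s ∉ halfOpenBox 2 ℓ).card ≤ 2 * ℓ := by
  classical
  have h10 : (1 : Fin 2) ≠ 0 := by decide
  calc ((halfOpenBox 2 ℓ).filter fun x => x + diagVec s ∉ halfOpenBox 2 ℓ).card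
      ≤ (((halfOpenBox 2 ℓ).filter fun x => x 0 = (ℓ : ℤ) - 1) ∪
          ((halfOpenBox 2 ℓ).filter fun x => x 1 = (if s = 0 then (ℓ : ℤ) - 1 else 0))).card := by
        refine Finset.card_le_card fun x hx => ?_
        rw [mem_filter] at hx
        rw [mem_union, mem_filter, mem_filter]
        rcases coord_eq_of_add_diagVec_not_mem hx.1 hx.2 with h | h
        exacts [Or.inl ⟨hx.1, h⟩, Or.inr ⟨hx.1, h⟩]
    _ ≤ ((halfOpenBox 2 ℓ).filter fun x => x 0 = (ℓ : ℤ) - 1).card +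
          ((halfOpenBox 2 ℓ).filter fun x => x 1 = (if s = 0 then (ℓ : ℤ) - 1 else 0)).card :=
        Finset.card_union_le _ _
    _ ≤ ℓ + ℓ := Nat.add_le_add
        (card_filter_apply_eq_le ℓ 0 1 (fun k hk => (fin_two_eq_zero_or_one k).resolve_left hk) _)
        (card_filter_apply_eq_le ℓ 1 0 (fun k hk => ((fin_two_eq_zero_or_one k).symm).resolve_left hk) _)
    _ = 2 * ℓ := by ring

/-! ### The `t–t'` mean energy versus the box Hamiltonians -/

/-- **The diagonal mean energy versus the diagonal box Hamiltonian**: for translation-invariant `ω`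
and the boxes `Λ_ℓ = [0,ℓ)²`, `|ℓ² Re ω(E^{t'}) - Re ω(H^{t'}_{Λ_ℓ})| ≤ 16|t'| ℓ` (the diagonal bonds
leaving the box, `≤ 2ℓ` per direction `s`, each of energy `≤ 4|t'|` in modulus, are counted with
weight `1` in `ℓ² Re ω(E^{t'})` and `0` in `H^{t'}_Λ`). [cite: BratteliRobinsonII1997, §6.2.4 (Prop. 6.2.38 ff.)] -/
theorem IsTranslationInvariant.abs_sq_mul_re_expect_diagHopping_meanEnergyObs_sub_le
    (hω : ω.IsTranslationInvariant) (ℓ : ℕ) :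
    |(ℓ : ℝ) ^ 2 * (ω.expect (thicken ({0} : Finset (Site 2)) 1) ((diagHoppingFermionInteraction t').meanEnergyObs 1)).re -
        (ω.expect (halfOpenBox 2 ℓ) ((diagHoppingFermionInteraction t').localHamiltonian (halfOpenBox 2 ℓ))).re| ≤
      16 * |t'| * ℓ := by
  classical
  set h : Fin 2 → ℂ := fun s =>
    ω.expect {0, 0 + diagVec s} ((diagHoppingFermionInteraction t').Φ {0, 0 + diagVec s}) with hh
  set c : Fin 2 → ℕ := fun s => ((halfOpenBox 2 ℓ).filter fun x => x + diagVec s ∈ halfOpenBox 2 ℓ).card with hc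
  have he : (ω.expect (thicken ({0} : Finset (Site 2)) 1) ((diagHoppingFermionInteraction t').meanEnergyObs 1)).re =
      ∑ s, (h s).re := by
    rw [hω.expect_diagHopping_meanEnergyObs t', Complex.re_sum]
  have hcard : (halfOpenBox 2 ℓ).card = ℓ ^ 2 := card_halfOpenBox 2 ℓ
  have hH : (ω.expect (halfOpenBox 2 ℓ) ((diagHoppingFermionInteraction t').localHamiltonian (halfOpenBox 2 ℓ))).re =
      ∑ s, (c s : ℝ) * (h s).re := by
    rw [hω.expect_diagHopping_localHamiltonian t' (halfOpenBox 2 ℓ), Complex.re_sum]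
    refine Finset.sum_congr rfl fun s _ => ?_
    rw [show ((c s : ℕ) : ℂ) = ((c s : ℝ) : ℂ) by norm_cast, Complex.re_ofReal_mul]
  -- `ℓ² - 2ℓ ≤ c s ≤ ℓ²`
  have hc_le : ∀ s, c s ≤ ℓ ^ 2 := fun s => hcard ▸ card_filter_le _ _
  have hc_ge : ∀ s, ℓ ^ 2 ≤ c s + 2 * ℓ := fun s => by
    have hsplit := Finset.card_filter_add_card_filter_not (s := halfOpenBox 2 ℓ) (fun x => x + diagVec s ∈ halfOpenBox 2 ℓ)
    have hbd := card_filter_add_diagVec_not_mem_halfOpenBox_le ℓ s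
    rw [hcard] at hsplit
    simp only [hc]
    omega
  have hdiff : (ℓ : ℝ) ^ 2 * (ω.expect (thicken ({0} : Finset (Site 2)) 1)
      ((diagHoppingFermionInteraction t').meanEnergyObs 1)).re -
      (ω.expect (halfOpenBox 2 ℓ) ((diagHoppingFermionInteraction t').localHamiltonian (halfOpenBox 2 ℓ))).re =
        ∑ s, ((ℓ : ℝ) ^ 2 - c s) * (h s).re := by
    rw [he, hH]
    simp only [Finset.mul_sum, sub_mul, Finset.sum_sub_distrib]
  rw [hdiff]
  calc |∑ s, ((ℓ : ℝ) ^ 2 - c s) * (h s).re| ≤ ∑ s, |((ℓ : ℝ) ^ 2 - c s) * (h s).re| := abs_sum_le_sum_abs _ _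
    _ ≤ ∑ _s : Fin 2, (2 * (ℓ : ℝ)) * (4 * |t'|) := by
        refine Finset.sum_le_sum fun s _ => ?_
        rw [abs_mul]
        refine mul_le_mul ?_ (abs_re_expect_diagHopping_pair_le t' ω s) (abs_nonneg _) (by positivity)
        have h1 : (c s : ℝ) ≤ (ℓ : ℝ) ^ 2 := by exact_mod_cast hc_le s
        have h2 : (ℓ : ℝ) ^ 2 ≤ c s + 2 * ℓ := by exact_mod_cast hc_ge s
        rw [abs_of_nonneg (by linarith)]
        linarith
    _ = 16 * |t'| * ℓ := by simp; ring

/-- **The `t–t'` mean energy through the term expectations**: for translation-invariant `ω`,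
`e^{tt'}(ω) = e^{t,U}(ω) + Σ_s Re ω(Φ^{t'}{0, j_s})` (the Hubbard energy density plus the two diagonal
bond energies). [cite: BratteliKishimotoRobinson1978, §3 (mean energy functional)] -/
theorem IsTranslationInvariant.meanEnergy_hubbardTTPrime_eq (hω : ω.IsTranslationInvariant) (t U : ℝ) :
    ω.meanEnergy (hubbardTTPrimeFermionInteraction t t' U) 1 =
      ω.hubbardEnergyDensity t U +
        ∑ s : Fin 2, (ω.expect {0, 0 + diagVec s} ((diagHoppingFermionInteraction t').Φ {0, 0 + diagVec s})).re := by
  rw [InfVolFermionState.meanEnergy, hubbardTTPrimeFermionInteraction_meanEnergyObs, map_add, Complex.add_re,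
    InfVolFermionState.hubbardEnergyDensity, InfVolFermionState.meanEnergy, hω.expect_diagHopping_meanEnergyObs t',
    Complex.re_sum]

/-- **Mean energy versus box Hamiltonian, `t–t'` model**: for a translation-invariant state `ω` on
`ℤ²` and the boxes `Λ_ℓ = [0,ℓ)²`, `|ℓ² e^{tt'}(ω) - Re ω(H^{tt'}_{Λ_ℓ})| ≤ (8|t| + 16|t'|) ℓ`, where
`e^{tt'}(ω) = ω.meanEnergy (hubbardTTPrimeFermionInteraction t t' U) 1` and `H^{tt'}_Λ = Σ_{X⊆Λ} Φ(X)`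
is the free-boundary box Hamiltonian (the nearest-neighbour bonds leaving the box are `≤ ℓ` per
direction with energy `≤ 4|t|`, the diagonal ones `≤ 2ℓ` per direction with energy `≤ 4|t'|`).
Bratteli–Robinson II §6.2.4 (the mean energy of a periodic state is `lim ω(H_Λ)/|Λ|`).
[cite: BratteliRobinsonII1997, §6.2.4 (Prop. 6.2.38 ff.)] -/
theorem IsTranslationInvariant.abs_sq_mul_meanEnergyTTPrime_sub_re_expect_localHamiltonian_le
    (hω : ω.IsTranslationInvariant) (t U : ℝ) (ℓ : ℕ) :
    |(ℓ : ℝ) ^ 2 * ω.meanEnergy (hubbardTTPrimeFermionInteraction t t' U) 1 -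
        (ω.expect (halfOpenBox 2 ℓ)
          ((hubbardTTPrimeFermionInteraction t t' U).localHamiltonian (halfOpenBox 2 ℓ))).re| ≤
      (8 * |t| + 16 * |t'|) * ℓ := by
  have h1 := hω.abs_sq_mul_hubbardEnergyDensity_sub_re_expect_localHamiltonian_le t U ℓ
  have h2 := hω.abs_sq_mul_re_expect_diagHopping_meanEnergyObs_sub_le t' ℓ
  rw [InfVolFermionState.meanEnergy, hubbardTTPrimeFermionInteraction_meanEnergyObs, map_add, Complex.add_re,
    hubbardTTPrimeFermionInteraction_localHamiltonian, map_add, Complex.add_re]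
  rw [InfVolFermionState.hubbardEnergyDensity, InfVolFermionState.meanEnergy] at h1
  rw [abs_le] at h1 h2 ⊢
  constructor <;> nlinarith [h1.1, h1.2, h2.1, h2.2]

end InfVolFermionState

end Literature.MathematicalPhysics.QuantumLattice

end
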